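import Literature.MathematicalPhysics.QuantumFieldTheory.Balaban1983to89.B16RatioResummation
import Literature.Probability.LatticeModels.ClusterExpansionKPBound

/-!
# `Balaban1983to89.B16RatioResummationProps` — properties of the hole-anchored activities of `B16RatioResummation`: LOCALITY ((1.91):
# *"depends on U_k restricted to X′"*), GENERATION of hole chains by unions of meeting pieces, CONTINUITY in a parameter, REALITY

Fourth of four files.  `holeAct_congr`: `holeAct … h v Y` only sees `h`, `v` on polymers inside `Y`.  `IsHoleChain.induct`: a hole chain is
generated from admissible hole polymers and catalogue members by unions of MEETING pairs (greedy growth along the sibling's link chains and inside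
Kotecký–Preiss clusters: `exists_link_of_isLConn`, `good_biUnion_of_isPolymerCluster`) — the form in which a consumer inherits «union of cells
over a connected cell family»; `IsHoleChain.exists_adm_subset`.  `continuousOn_holeAct`: continuity in a parameter on a set where the catalogue
stays Kotecký–Preiss (`LatticeModels.continuousOn_polymerLogZ_param`, zero-freeness along rays `ne_zero_ray_of_kp`).  `holeAct_im_eq_zero`: real
activities give real hole-anchored activities (`LatticeModels.polymerLogZ_eq_log_of_real`).

Parts G–H (inputs of the activity bound of `B16RatioResummationBound`): `norm_mayerU_le` (`‖e^{−Φ} − 1‖ ≤ ‖Φ‖e^{‖Φ‖}`), `sz_fp_le` (a sub-additive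
size of a footprint is distributed over the items), and the consequences of [KoteckyPreiss1986] (4) for the vacuum gas: `isKPVolume_of_kp`,
`sum_touch_le`, `norm_truncatedWeight_le_of_mem` (`‖Φ^T(C)‖ ≤ A₀` on the catalogue), `sum_mayer_touch_le` (the attached-cluster sum of one hole
polymer is `≤ e^{A₀}·a(X)`).

NOT CLAIMED: the activity bound itself (next file); anything analytic.  No `sorry`; no definitions; no named fact.

References: [Balaban1989LargeFieldII] T. Bałaban, *Large field renormalization. II. Localization, exponentiation, and bounds for the
𝐑 operation*, Commun. Math. Phys. **122** (1989) 355–392, pp. 387–388 (1.90)–(1.91); [KoteckyPreiss1986] R. Kotecký, D. Preiss, *Cluster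
expansion for abstract polymer models*, Commun. Math. Phys. **103** (1986) 491–498, (5) and Theorem p. 492; [Dimock2013BalabanII] J. Dimock,
*The renormalization group according to Balaban II. Large fields*, J. Math. Phys. **54** (2013) 092301, App. F (the same resummation for
scalar fields, template only).
-/

namespace Literature.MathematicalPhysics.QuantumFieldTheory.Balaban1983to89.B16RatioResummation

open Classical
open Finset
open Literature.Probability.LatticeModels
open Literature.MathematicalPhysics.QuantumFieldTheory.Balaban1983to89.B16Eq190Resummation

noncomputable section

variable {α : Type*} [DecidableEq α]

/-! ## Part F. Properties of the hole-anchored activities: locality, generation of hole chains, continuity, reality -/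

section Props

variable [Fintype α]

omit [Fintype α] in
/-- A cluster item's members lie inside the footprint of its family. [cite: Balaban1989LargeFieldII, (1.91) p.388] -/
theorem subset_fp_of_mem_toRight {T : Finset (Item α)} {C : CItem α} (hC : C ∈ T.toRight) {γ : Finset α} (hγ : γ ∈ C.1) :
    γ ⊆ fp loc T := by
  intro a ha
  simp only [fp, mem_biUnion]
  refine ⟨Sum.inr C, mem_toRight.1 hC, ?_⟩
  simp only [loc, Sum.elim_inr, mem_biUnion, id]
  exact ⟨γ, hγ, ha⟩

/-- **LOCALITY ((1.91): the activity of `X′` «depends on U_k restricted to X′»)**: `ζ(Y)` only sees the hole activities of polymers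
inside `Y` and the vacuum activities of polymers inside `Y`. [cite: Balaban1989LargeFieldII, (1.91) p.388] -/
theorem holeAct_congr {adm : Finset α → Prop} {Λ : Finset (Finset α)} {Q : Finset α} {h h' v v' : Finset α → ℂ} {Y : Finset α}
    (hh : ∀ X, X ⊆ Y → h X = h' X) (hv : ∀ γ, γ ⊆ Y → v γ = v' γ) :
    holeAct adm Λ Q h v Y = holeAct adm Λ Q h' v' Y := by
  classical
  unfold holeAct F
  refine Finset.sum_congr rfl fun T hT => ?_
  obtain ⟨-, hfp⟩ := mem_fibC.1 hT
  unfold termWCov termW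
  split_ifs with hcov hok
  · congr 1
    · exact Finset.prod_congr rfl fun X hX => hh X.1 (hfp ▸ subset_fp_of_mem_toLeft hX)
    · refine Finset.prod_congr rfl fun C hC => ?_
      unfold mayerU
      rw [truncatedWeight_congr (w' := v') fun γ hγ => hv γ (hfp ▸ subset_fp_of_mem_toRight hC hγ)]
  · rfl
  · rfl

/-- **LOCALITY IN THE HOLE DATA**: `ζ(Y)` only sees the admissibility of polymers inside `Y` and the marked points inside `Y` (so the activity
of `Y` under a history `Q` depends on `Q` only through the holes located in `Y`). [cite: Balaban1989LargeFieldII, (1.91) p.388] -/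
theorem holeAct_congr_left {adm adm' : Finset α → Prop} {Λ : Finset (Finset α)} {Q Q' : Finset α} {h v : Finset α → ℂ} {Y : Finset α}
    (hadm : ∀ X, X ⊆ Y → (adm X ↔ adm' X)) (hQ : ∀ b ∈ Y, b ∈ Q ↔ b ∈ Q') :
    holeAct adm Λ Q h v Y = holeAct adm' Λ Q' h v Y := by
  classical
  unfold holeAct F
  refine Finset.sum_congr rfl fun T hT => ?_
  obtain ⟨-, hfp⟩ := mem_fibC.1 hT
  have h1 : LocCov Q T ↔ LocCov Q' T := by
    constructor
    · intro H b hb hbT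
      exact H b ((hQ b (hfp ▸ hbT)).2 hb) hbT
    · intro H b hb hbT
      exact H b ((hQ b (hfp ▸ hbT)).1 hb) hbT
  have h2 : TermOk adm Λ T ↔ TermOk adm' Λ T := by
    unfold TermOk
    have key : (∀ X ∈ T.toLeft, adm X.1) ↔ ∀ X ∈ T.toLeft, adm' X.1 :=
      ⟨fun H X hX => (hadm X.1 (hfp ▸ subset_fp_of_mem_toLeft hX)).1 (H X hX),
        fun H X hX => (hadm X.1 (hfp ▸ subset_fp_of_mem_toLeft hX)).2 (H X hX)⟩
    rw [key]
  unfold termWCov termW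
  by_cases hc : LocCov Q T
  · by_cases ho : TermOk adm Λ T
    · rw [if_pos hc, if_pos ho, if_pos (h1.1 hc), if_pos (h2.1 ho)]
    · rw [if_pos hc, if_neg ho, if_pos (h1.1 hc), if_neg (fun H => ho (h2.2 H))]
  · rw [if_neg hc, if_neg (fun H => hc (h1.2 H))]

omit [Fintype α] in
/-- **Greedy generation of a chained union**: if the pieces of a finite family are `Good`, any splitting of the family has a related
pair across it, related pieces MEET, and `Good` is stable under unions of meeting sets, then the union of the family is `Good`.
[folklore] -/
private theorem good_biUnion_of_chain {ι : Type*} [DecidableEq ι] {Good : Finset α → Prop}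
    (hunion : ∀ A B, Good A → Good B → (A ∩ B).Nonempty → Good (A ∪ B)) (T : Finset ι) (f : ι → Finset α)
    (rel : ι → ι → Prop) (hchain : ∀ T₁ ⊆ T, T₁.Nonempty → (T \ T₁).Nonempty → ∃ u ∈ T₁, ∃ w ∈ T \ T₁, rel u w)
    (hrel : ∀ u ∈ T, ∀ w ∈ T, rel u w → (f u ∩ f w).Nonempty) (hT : T.Nonempty) (hf : ∀ u ∈ T, Good (f u)) :
    Good (T.biUnion f) := by
  -- `P k`: a good sub-union of exactly `k` pieces
  have key : ∀ k, 1 ≤ k → k ≤ T.card → ∃ T₁ ⊆ T, T₁.card = k ∧ Good (T₁.biUnion f) := by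
    intro k hk hkT
    induction k with
    | zero => omega
    | succ k ih =>
      rcases Nat.eq_zero_or_pos k with rfl | hkpos
      · obtain ⟨u, hu⟩ := hT
        exact ⟨{u}, singleton_subset_iff.2 hu, card_singleton u, by simpa using hf u hu⟩
      · obtain ⟨T₁, hT₁T, hcard, hgood⟩ := ih hkpos (Nat.le_of_succ_le hkT)
        have hne : T₁.Nonempty := card_pos.1 (by omega)
        have hsd : (T \ T₁).Nonempty := by
          rw [← card_pos, card_sdiff_of_subset hT₁T]; omega
        obtain ⟨u, hu, w, hw, huw⟩ := hchain T₁ hT₁T hne hsd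
        obtain ⟨hwT, hwT₁⟩ := mem_sdiff.1 hw
        refine ⟨insert w T₁, insert_subset hwT hT₁T, by rw [card_insert_of_notMem hwT₁, hcard], ?_⟩
        rw [biUnion_insert, union_comm]
        refine hunion _ _ hgood (hf w hwT) ?_
        obtain ⟨a, ha⟩ := hrel u (hT₁T hu) w hwT huw
        exact ⟨a, mem_inter.2 ⟨mem_biUnion.2 ⟨u, hu, (mem_inter.1 ha).1⟩, (mem_inter.1 ha).2⟩⟩
  obtain ⟨T₁, hT₁T, hcard, hgood⟩ := key T.card (card_pos.2 hT) le_rfl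
  rwa [eq_of_subset_of_card_le hT₁T hcard.ge] at hgood

omit [Fintype α] in
/-- A connected item family splits nowhere: every proper non-empty part is linked to its complement. [cite: Balaban1989LargeFieldII, (1.90) p.388] -/
theorem exists_link_of_isLConn {ι : Type*} [DecidableEq ι] {lk : ι → ι → Prop} {T : Finset ι} (hT : IsLConn lk T) (T₁ : Finset ι) (hT₁ : T₁ ⊆ T)
    (hne : T₁.Nonempty) (hsd : (T \ T₁).Nonempty) : ∃ u ∈ T₁, ∃ w ∈ T \ T₁, lk u w := by
  obtain ⟨a, ha⟩ := hne
  obtain ⟨b, hb⟩ := hsd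
  have hab := hT.2 a (hT₁ ha) b (mem_sdiff.1 hb).1
  -- walk along the chain from `a ∈ T₁` to `b ∉ T₁`; the first exit is the link
  suffices H : ∀ c, LReach lk T a c → c ∉ T₁ → ∃ u ∈ T₁, ∃ w ∈ T \ T₁, lk u w from H b hab (mem_sdiff.1 hb).2
  intro c hac hc
  induction hac with
  | refl => exact absurd ha hc
  | @tail x y _ hxy ih =>
    by_cases hx : x ∈ T₁
    · exact ⟨x, hx, y, mem_sdiff.2 ⟨hxy.2.2, hc⟩, hxy.1⟩
    · exact ih hx

omit [Fintype α] in
/-- The support of a Kotecký–Preiss cluster of non-empty subset polymers is generated from its members by unions of meeting sets.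
[cite: KoteckyPreiss1986, §2 (clusters)] -/
theorem good_biUnion_of_isPolymerCluster {Good : Finset α → Prop}
    (hunion : ∀ A B, Good A → Good B → (A ∩ B).Nonempty → Good (A ∪ B)) {C : Finset (Finset α)} (hC : IsPolymerCluster polyInc C)
    (hCne : C.Nonempty) (hne : ∀ γ ∈ C, γ.Nonempty) (hgood : ∀ γ ∈ C, Good γ) : Good (C.biUnion id) := by
  refine good_biUnion_of_chain hunion C id polyInc (fun C₁ hC₁ h1 h2 => hC C₁ hC₁ h1 h2) (fun γ hγ γ' _ hp => ?_) hCne hgood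
  rcases hp with h | h
  · rw [id, id, h, inter_self]; exact h ▸ hne γ hγ
  · exact h

/-- **HOLE CHAINS ARE GENERATED**: a hole chain is obtained from admissible (non-empty) hole polymers and members of the catalogue by
unions of MEETING pairs; hence every property of subsets stable under such unions and holding for those generators holds for every
hole chain (used for: «a hole chain is a union of cells over a connected family of cells»). [cite: Balaban1989LargeFieldII, (1.90) p.388] -/
theorem IsHoleChain.induct {adm : Finset α → Prop} {Λ : Finset (Finset α)} {Y : Finset α} (hY : IsHoleChain adm Λ Y)
    {Good : Finset α → Prop} (hadmG : ∀ X, adm X → X.Nonempty → Good X) (hΛG : ∀ γ ∈ Λ, Good γ)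
    (hunion : ∀ A B, Good A → Good B → (A ∩ B).Nonempty → Good (A ∪ B)) : Good Y := by
  classical
  obtain ⟨T, hT, rfl, -, hadmT, hclT⟩ := hY
  refine good_biUnion_of_chain hunion T loc link (fun T₁ h1 h2 h3 => exists_link_of_isLConn hT T₁ h1 h2 h3)
    (fun u _ w _ huw => (link_iff u w).1 huw) hT.1 fun u hu => ?_
  rcases u with X | C
  · exact hadmG X.1 (hadmT X (mem_toLeft.2 hu)) X.2
  · obtain ⟨hCΛ, hcl⟩ := hclT C (mem_toRight.2 hu)
    simpa [loc] using good_biUnion_of_isPolymerCluster hunion hcl C.2.1 C.2.2 fun γ hγ => hΛG γ (hCΛ hγ)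

/-- A hole chain contains an admissible hole polymer. [cite: Balaban1989LargeFieldII, (1.90) p.388] -/
theorem IsHoleChain.exists_adm_subset {adm : Finset α → Prop} {Λ : Finset (Finset α)} {Y : Finset α} (hY : IsHoleChain adm Λ Y) :
    ∃ X, adm X ∧ X.Nonempty ∧ X ⊆ Y := by
  obtain ⟨T, -, rfl, ⟨X, hX⟩, hadmT, -⟩ := hY
  exact ⟨X.1, hadmT X hX, X.2, subset_fp_of_mem_toLeft hX⟩

omit [Fintype α] in
/-- In a Kotecký–Preiss volume the partition functions along the rays `u • v`, `u ∈ [0,1]`, of every sub-volume do not vanish.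
[cite: KoteckyPreiss1986, Theorem p. 492 (zero-freeness)] -/
theorem ne_zero_ray_of_kp {v : Finset α → ℂ} {a : Finset α → ℝ} {Λ : Finset (Finset α)} (hKP : IsKPVolume polyInc v a Λ)
    {B : Finset (Finset α)} (hB : B ⊆ Λ) {u : ℝ} (hu : u ∈ Set.Icc (0 : ℝ) 1) :
    polymerPartitionFunction polyInc (fun γ => (u : ℂ) * v γ) B ≠ 0 := by
  have hKPt : IsKPVolume polyInc (fun γ => (u : ℂ) * v γ) a Λ := fun γ hγ => by
    refine le_trans (Finset.sum_le_sum fun γ' _ => ?_) (hKP γ hγ)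
    unfold kpTerm
    refine mul_le_mul_of_nonneg_right ?_ (Real.exp_nonneg _)
    rw [norm_mul, Complex.norm_real, Real.norm_eq_abs, abs_of_nonneg hu.1]
    exact mul_le_of_le_one_left (norm_nonneg _) hu.2
  exact polymerPartitionFunction_ne_zero_of_kp hKPt hB

/-- **CONTINUITY IN A PARAMETER**: if the hole and vacuum activities depend continuously on a parameter on a set where the vacuum
catalogue stays Kotecký–Preiss, so does every hole-anchored activity (finite sums and products of `h`, `e^{−Φ^T(C)} − 1`, the latter
continuous by `LatticeModels.continuousOn_polymerLogZ_param`). [cite: KoteckyPreiss1986, §2 (log 𝒵 continuous on the zero-free set)] -/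
theorem continuousOn_holeAct {X : Type*} [TopologicalSpace X] {s : Set X} (adm : Finset α → Prop) {Λ : Finset (Finset α)}
    (Q : Finset α) {hf vf : X → Finset α → ℂ} {a : Finset α → ℝ} (hh : ∀ Y, ContinuousOn (fun x => hf x Y) s)
    (hv : ∀ γ ∈ Λ, ContinuousOn (fun x => vf x γ) s) (hKP : ∀ x ∈ s, IsKPVolume polyInc (vf x) a Λ) (Y : Finset α) :
    ContinuousOn (fun x => holeAct adm Λ Q (hf x) (vf x) Y) s := by
  classical
  unfold holeAct F
  refine continuousOn_finsetSum _ fun T _ => ?_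
  unfold termWCov termW
  by_cases hcov : LocCov Q T
  · simp only [if_pos hcov]
    by_cases hok : TermOk adm Λ T
    · simp only [if_pos hok]
      refine (continuousOn_finsetProd _ fun X' _ => hh X'.1).mul (continuousOn_finsetProd _ fun C hC => ?_)
      have hCΛ : C.1 ⊆ Λ := (hok.2.2 C hC).1
      unfold mayerU truncatedWeight
      refine ContinuousOn.sub (ContinuousOn.cexp (ContinuousOn.neg (continuousOn_finsetSum _ fun B hB => ?_))) continuousOn_const
      have hBΛ : B ⊆ Λ := (mem_powerset.1 hB).trans hCΛ
      exact continuousOn_const.mul (continuousOn_polymerLogZ_param B (fun γ hγ => hv γ (hBΛ hγ))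
        fun x hx u hu => ne_zero_ray_of_kp (hKP x hx) hBΛ hu)
    · simp only [if_neg hok]; exact continuousOn_const
  · simp only [if_neg hcov]; exact continuousOn_const

/-- **REALITY**: for real hole and vacuum activities (the latter Kotecký–Preiss) every hole-anchored activity is real.
[cite: KoteckyPreiss1986, §2] -/
theorem holeAct_im_eq_zero {adm : Finset α → Prop} {Λ : Finset (Finset α)} {Q : Finset α} {h v : Finset α → ℂ} {a : Finset α → ℝ}
    (hKP : IsKPVolume polyInc v a Λ) (hh : ∀ X, (h X).im = 0) (hv : ∀ γ, (v γ).im = 0) (Y : Finset α) :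
    (holeAct adm Λ Q h v Y).im = 0 := by
  classical
  have hreal : ∀ X, h X = ((h X).re : ℂ) := fun X => Complex.ext (by simp) (by simp [hh X])
  unfold holeAct F
  rw [Complex.im_sum]
  refine Finset.sum_eq_zero fun T _ => ?_
  unfold termWCov termW
  split_ifs with hcov hok
  · have h1 : (∏ X ∈ T.toLeft, h X.1) = ((∏ X ∈ T.toLeft, (h X.1).re : ℝ) : ℂ) := by
      rw [Complex.ofReal_prod]; exact Finset.prod_congr rfl fun X _ => hreal X.1
    have h2 : ∀ C ∈ T.toRight, mayerU v C.1 = ((Real.exp (-(∑ B ∈ C.1.powerset,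
        (-1 : ℝ) ^ (C.1 \ B).card * Real.log (polymerPartitionFunction polyInc v B).re)) - 1 : ℝ) : ℂ) := by
      intro C hC
      have hCΛ : C.1 ⊆ Λ := (hok.2.2 C hC).1
      unfold mayerU truncatedWeight
      push_cast
      congr 2
      refine congrArg Neg.neg (Finset.sum_congr rfl fun B hB => ?_)
      rw [(polymerLogZ_eq_log_of_real hv fun u hu => ne_zero_ray_of_kp hKP ((mem_powerset.1 hB).trans hCΛ) hu).2]
    rw [h1, Finset.prod_congr rfl h2, ← Complex.ofReal_prod, ← Complex.ofReal_mul, Complex.ofReal_im]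
  · simp
  · simp

end Props

section KPInputs

variable [Fintype α]

/-! ## Part G. Elementary inequalities -/

omit [DecidableEq α] [Fintype α] in
/-- `e^x − 1 ≤ x·e^x`. [folklore] -/
private theorem exp_sub_one_le_mul_exp (x : ℝ) : Real.exp x - 1 ≤ x * Real.exp x := by
  have h := Real.one_sub_le_exp_neg x
  have hpos := Real.exp_pos x
  have : Real.exp x * (1 - x) ≤ Real.exp x * Real.exp (-x) := mul_le_mul_of_nonneg_left h hpos.le
  rw [← Real.exp_add, add_neg_cancel, Real.exp_zero] at this
  nlinarith

omit [Fintype α] in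
/-- The Mayer factor is controlled by the truncated function: `‖e^{−Φ} − 1‖ ≤ ‖Φ‖·e^{‖Φ‖}`. [cite: KoteckyPreiss1986, (5)] -/
theorem norm_mayerU_le (v : Finset α → ℂ) (C : Finset (Finset α)) :
    ‖mayerU v C‖ ≤ ‖truncatedWeight polyInc v C‖ * Real.exp ‖truncatedWeight polyInc v C‖ := by
  unfold mayerU
  refine (norm_cexp_sub_one_le_exp_norm_sub_one _).trans ?_
  rw [norm_neg]
  exact exp_sub_one_le_mul_exp _

omit [DecidableEq α] [Fintype α] in
/-- A sub-additive size vanishing at `∅` is sub-additive over finite unions. [folklore] -/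
private theorem sz_biUnion_le {ι : Type*} [DecidableEq ι] [DecidableEq α] {sz : Finset α → ℝ} (hsze : sz ∅ = 0)
    (hsz : ∀ A B, sz (A ∪ B) ≤ sz A + sz B) (s : Finset ι) (f : ι → Finset α) :
    sz (s.biUnion f) ≤ ∑ i ∈ s, sz (f i) := by
  induction s using Finset.induction_on with
  | empty => simp [hsze]
  | insert i s hi ih =>
    rw [biUnion_insert, sum_insert hi]
    exact (hsz _ _).trans (by linarith)

omit [Fintype α] in
/-- **(i) The size of a footprint is distributed over the items of the term.** [cite: Balaban1989LargeFieldII, (1.97) p.389] -/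
theorem sz_fp_le {sz : Finset α → ℝ} (hsze : sz ∅ = 0) (hsz : ∀ A B, sz (A ∪ B) ≤ sz A + sz B) (T : Finset (Item α)) :
    sz (fp loc T) ≤ ∑ X ∈ T.toLeft, sz X.1 + ∑ C ∈ T.toRight, ∑ γ ∈ C.1, sz γ := by
  have h1 : sz (fp loc T) ≤ ∑ u ∈ T, sz (loc u) := sz_biUnion_le hsze hsz T loc
  have h2 : ∑ u ∈ T, sz (loc u) = ∑ X ∈ T.toLeft, sz X.1 + ∑ C ∈ T.toRight, sz (C.1.biUnion id) := by
    conv_lhs => rw [← toLeft_disjSum_toRight (u := T)]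
    rw [sum_disjSum]
    rfl
  have h3 : ∀ C ∈ T.toRight, sz (C.1.biUnion id) ≤ ∑ γ ∈ C.1, sz γ := fun C _ => by
    simpa using sz_biUnion_le hsze hsz C.1 id
  rw [h2] at h1
  exact h1.trans (by gcongr with C hC; exact h3 C hC)

/-! ## Part H. Consequences of the Kotecký–Preiss estimate (4) -/

section KP

variable {v : Finset α → ℂ} {a d : Finset α → ℝ}

/-- The finite global Kotecký–Preiss hypothesis (1) in the tree's form. [cite: KoteckyPreiss1986, (1)] -/
theorem kp_h1_of_finite (hKP : ∀ σ : Finset α, ∑ γ' ∈ Finset.univ.filter (fun γ' => polyInc γ' σ), ‖v γ'‖ * Real.exp (a γ' + d γ') ≤ a σ)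
    (σ : Finset α) :
    Summable (fun γ' : {γ' : Finset α // polyInc γ' σ} => ‖v γ'‖ * Real.exp (a γ' + d γ')) ∧
      ∑' γ' : {γ' : Finset α // polyInc γ' σ}, ‖v γ'‖ * Real.exp (a γ' + d γ') ≤ a σ :=
  kp_hypothesis_of_fintype (inc := polyInc) hKP σ

/-- (1) implies the finite-volume Kotecký–Preiss condition on every catalogue. [cite: KoteckyPreiss1986, (1)] -/
theorem isKPVolume_of_kp (hd : ∀ γ, 0 ≤ d γ)
    (hKP : ∀ σ : Finset α, ∑ γ' ∈ Finset.univ.filter (fun γ' => polyInc γ' σ), ‖v γ'‖ * Real.exp (a γ' + d γ') ≤ a σ)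
    (Λ : Finset (Finset α)) : IsKPVolume polyInc v a Λ := by
  intro γ hγ
  refine le_trans ?_ (hKP γ)
  refine le_trans (Finset.sum_le_sum_of_subset_of_nonneg (fun γ' hγ' => ?_) fun γ' _ _ => kpTerm_nonneg v a γ')
    (Finset.sum_le_sum fun γ' _ => ?_)
  · exact mem_filter.2 ⟨mem_univ _, (mem_filter.1 hγ').2⟩
  · unfold kpTerm
    exact mul_le_mul_of_nonneg_left (Real.exp_le_exp.2 (le_add_of_nonneg_right (hd γ'))) (norm_nonneg _)

/-- **(4), touching form**: `Σ_{C ∈ 𝒞, C ι X} ‖Φ^T(C)‖·e^{d(C)} ≤ a(X)` for any finite family `𝒞`. [cite: KoteckyPreiss1986, Theorem p. 492, estimate (4)] -/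
theorem sum_touch_le (ha : ∀ γ, 0 ≤ a γ) (hd : ∀ γ, 0 ≤ d γ)
    (hKP : ∀ σ : Finset α, ∑ γ' ∈ Finset.univ.filter (fun γ' => polyInc γ' σ), ‖v γ'‖ * Real.exp (a γ' + d γ') ≤ a σ)
    (𝒞 : Finset (Finset (Finset α))) (X : Finset α) :
    ∑ C ∈ 𝒞.filter (fun C => KPTouches polyInc C X), ‖truncatedWeight polyInc v C‖ * Real.exp (∑ γ' ∈ C, d γ') ≤ a X :=
  sum_norm_truncatedWeight_mul_exp_le_of_touches (koteckyPreiss_truncatedWeight_bound_holds polyInc v a d) ha hd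
    (kp_h1_of_finite hKP) 𝒞 X

/-- **(ii) The truncated functions are uniformly small on the catalogue**: `‖Φ^T(C)‖ ≤ a(γ₀)·e^{−d(γ₀)} ≤ A₀` for `γ₀ ∈ C ⊆ Λ`.
[cite: KoteckyPreiss1986, Theorem p. 492, estimate (4)] -/
theorem norm_truncatedWeight_le_of_mem (ha : ∀ γ, 0 ≤ a γ) (hd : ∀ γ, 0 ≤ d γ)
    (hKP : ∀ σ : Finset α, ∑ γ' ∈ Finset.univ.filter (fun γ' => polyInc γ' σ), ‖v γ'‖ * Real.exp (a γ' + d γ') ≤ a σ)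
    {Λ : Finset (Finset α)} {A₀ : ℝ} (hA₀ : ∀ γ ∈ Λ, a γ * Real.exp (-d γ) ≤ A₀) {C : Finset (Finset α)} (hC : C ⊆ Λ) {γ₀ : Finset α}
    (hγ₀ : γ₀ ∈ C) : ‖truncatedWeight polyInc v C‖ ≤ A₀ := by
  have h := sum_touch_le ha hd hKP {C} γ₀
  have hmem : C ∈ ({C} : Finset (Finset (Finset α))).filter (fun C' => KPTouches polyInc C' γ₀) :=
    mem_filter.2 ⟨mem_singleton_self C, γ₀, hγ₀, Or.inl rfl⟩
  have hsingle := single_le_sum (f := fun C' => ‖truncatedWeight polyInc v C'‖ * Real.exp (∑ γ' ∈ C', d γ'))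
    (fun C' _ => mul_nonneg (norm_nonneg _) (Real.exp_nonneg _)) hmem
  have hdC : d γ₀ ≤ ∑ γ' ∈ C, d γ' := single_le_sum (fun γ' _ => hd γ') hγ₀
  have key : ‖truncatedWeight polyInc v C‖ * Real.exp (d γ₀) ≤ a γ₀ :=
    le_trans (mul_le_mul_of_nonneg_left (Real.exp_le_exp.2 hdC) (norm_nonneg _)) (hsingle.trans h)
  calc ‖truncatedWeight polyInc v C‖ = ‖truncatedWeight polyInc v C‖ * Real.exp (d γ₀) * Real.exp (-d γ₀) := by
        rw [mul_assoc, ← Real.exp_add, add_neg_cancel, Real.exp_zero, mul_one]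
    _ ≤ a γ₀ * Real.exp (-d γ₀) := mul_le_mul_of_nonneg_right key (Real.exp_nonneg _)
    _ ≤ A₀ := hA₀ γ₀ (hC hγ₀)

/-- **(iii) The attached-cluster sum of one hole polymer**: `Σ_{C ⊆ Λ, C ι X} ‖u_C‖·e^{κ′·Σ_{γ∈C} sz γ} ≤ e^{A₀}·a(X)`.
[cite: Balaban1989LargeFieldII, (1.97) p.389] -/
theorem sum_mayer_touch_le (ha : ∀ γ, 0 ≤ a γ) (hd : ∀ γ, 0 ≤ d γ)
    (hKP : ∀ σ : Finset α, ∑ γ' ∈ Finset.univ.filter (fun γ' => polyInc γ' σ), ‖v γ'‖ * Real.exp (a γ' + d γ') ≤ a σ)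
    {Λ : Finset (Finset α)} {A₀ κ' : ℝ} (hA₀ : ∀ γ ∈ Λ, a γ * Real.exp (-d γ) ≤ A₀) {sz : Finset α → ℝ} (hdγ : ∀ γ ∈ Λ, κ' * sz γ ≤ d γ)
    (X : Finset α) :
    ∑ C ∈ Λ.powerset.filter (fun C => KPTouches polyInc C X), ‖mayerU v C‖ * Real.exp (κ' * ∑ γ ∈ C, sz γ) ≤ Real.exp A₀ * a X := by
  have h4 := sum_touch_le ha hd hKP Λ.powerset X
  have hterm : ∀ C ∈ Λ.powerset.filter (fun C => KPTouches polyInc C X),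
      ‖mayerU v C‖ * Real.exp (κ' * ∑ γ ∈ C, sz γ) ≤
        Real.exp A₀ * (‖truncatedWeight polyInc v C‖ * Real.exp (∑ γ' ∈ C, d γ')) := by
    intro C hC
    obtain ⟨hCΛ, γ₀, hγ₀, -⟩ := mem_filter.1 hC
    have hCΛ' := mem_powerset.1 hCΛ
    have hΦ := norm_truncatedWeight_le_of_mem ha hd hKP hA₀ hCΛ' hγ₀
    have hexp : Real.exp (κ' * ∑ γ ∈ C, sz γ) ≤ Real.exp (∑ γ' ∈ C, d γ') := by
      refine Real.exp_le_exp.2 ?_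
      rw [Finset.mul_sum]
      exact Finset.sum_le_sum fun γ hγ => hdγ γ (hCΛ' hγ)
    calc ‖mayerU v C‖ * Real.exp (κ' * ∑ γ ∈ C, sz γ)
        ≤ (‖truncatedWeight polyInc v C‖ * Real.exp ‖truncatedWeight polyInc v C‖) * Real.exp (∑ γ' ∈ C, d γ') :=
          mul_le_mul (norm_mayerU_le v C) hexp (Real.exp_nonneg _) (mul_nonneg (norm_nonneg _) (Real.exp_nonneg _))
      _ ≤ (‖truncatedWeight polyInc v C‖ * Real.exp A₀) * Real.exp (∑ γ' ∈ C, d γ') :=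
          mul_le_mul_of_nonneg_right (mul_le_mul_of_nonneg_left (Real.exp_le_exp.2 hΦ) (norm_nonneg _)) (Real.exp_nonneg _)
      _ = Real.exp A₀ * (‖truncatedWeight polyInc v C‖ * Real.exp (∑ γ' ∈ C, d γ')) := by ring
  refine (Finset.sum_le_sum hterm).trans ?_
  rw [← Finset.mul_sum]
  exact mul_le_mul_of_nonneg_left h4 (Real.exp_nonneg _)

end KP

end KPInputs

end

end Literature.MathematicalPhysics.QuantumFieldTheory.Balaban1983to89.B16RatioResummation
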